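import Summits.CriticalPhenomena.Ising3D.TaylorKernelPDInterval
import Summits.CriticalPhenomena.Ising3D.TaylorConeOddCells
import Literature.Analysis.ValidatedNumerics.TaylorModelExp
import Literature.MathematicalPhysics.QuantumFieldTheory.ConformalBootstrap3D.HRCoeffTM
import Mathlib.Tactic.Linarith
import Mathlib.Tactic.Positivity
import Mathlib.Tactic.Ring
import HarnessLib

/-!
# A kernel-computable positivity checker on a half-strip `{P ≥ P₀} × {θ ∈ [0,1]}` (region obligations)
(cell `pub-ising3x`, seat recog-1 gen 11; gate (g2): the generic decision procedure behind the kernel-route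
region checks of both sectors — `TaylorKernelSymm` reduces them to exactly this shape)

HONEST FRAMING: lottery ticket; floor = tightest certified 3D Ising CFT bounds; no exact-solution
claim without a proof.

Data: a bivariate interval list `H : IPoly2` enclosing (`PMem2`) a real shadow `G` read as
`G(P, θ) = eval2 G P θ = Σ_k g_k(P) θ^k` (rows = polynomials in `P`, outer index = power of `θ`), a left end
`P₀ : ℚ` and parameters `(P₁, nθ, dP)`. The checker `halfStripPos` decides, in exact integer/rational
arithmetic over the tree's `PolyMP` layer:
* (top columns whose entries are all the thin zero — padding — are dropped first: `effCols`;)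
* UNBOUNDED PART `P ≥ P₁ (≥ 1)`: with `M` columns `c_i(θ) = Σ_k g_{k,i} θ^k` (`G = Σ_i c_i(θ) P^i`,
  `eval2_eq_sum_colR`), a scaled lower bound `L > 0` of the top column on `[0,1]` and scaled absolute bounds
  `B_i` of the others (`enclI` = Taylor shift to the midpoint + `tlowerI`/`tupperI`), the Cauchy-type test
  `Σ_{i<d} B_i < L·P₁` gives `G > 0` (`G·S ≥ P^{d-1}(L P - Σ B_i)`);
* BOX PART `[P₀, P₁] × [0,1]`: `nθ` uniform θ-cells; on each, every column is enclosed in one `MI` and the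
  resulting interval polynomial in `P` is handed to the tree's sign checker `posOn` (bisection depth `dP`).
**`halfStripPos_sound`**: `halfStripPos S H P₀ prm = true`, `PMem2 S G H` ⇒ `0 < eval2 G P θ` for all real
`P ≥ P₀`, `θ ∈ [0,1]`. Standard validated numerics (Moore 1966 Ch. 3; the tree's `posOn_sound`,
`tlowerI_le`/`le_tupperI`). Elementary. [folklore]
-/

namespace Summit.CriticalPhenomena.Ising3D

open Finset
open Literature.Analysis.ValidatedNumerics Literature.Analysis.ValidatedNumerics.PolyMP
open Literature.Analysis.ValidatedNumerics.NumericsMP (MI)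

/-! ### Enclosing a polynomial on an interval `|θ - c| ≤ h` -/

/-- `[tlowerI, tupperI]` of the Taylor shift to the midpoint: an `MI` enclosure of `p` on `|θ - c| ≤ h`.
[folklore] -/
def enclI (S : ℕ) (p : IPoly) (c h : ℚ) : MI :=
  ⟨tlowerI S h (shiftI S p (PolyMP.ofRat S c)), tupperI S h (shiftI S p (PolyMP.ofRat S c))⟩

/-- [folklore] -/
theorem mem_enclI {S : ℕ} (hS : 0 < S) {as : List ℝ} {p : IPoly} (has : PMem S as p) {c h : ℚ}
    (h0 : 0 ≤ h) {θ : ℝ} (hθ : |θ - c| ≤ h) : MI.mem S (evalR as θ) (enclI S p c h) := by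
  have hsh : PMem S (shiftR as c) (shiftI S p (PolyMP.ofRat S c)) := pmem_shiftI hS (mem_ofRat S c) has
  have htm : TMem S h (fun ρ => evalR (shiftR as (c : ℝ)) ρ) (shiftI S p (PolyMP.ofRat S c)) :=
    fun ρ _ => ⟨_, hsh, rfl⟩
  have e : evalR as θ = evalR (shiftR as c) (θ - c) := by rw [evalR_shiftR]; congr 1; ring
  rw [e]
  exact ⟨tlowerI_le h0 htm hθ, le_tupperI h0 htm hθ⟩

/-! ### Columns -/

/-- Column `i` of a bivariate interval list (a polynomial in the OUTER variable). [folklore] -/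
def colI (H : IPoly2) (i : ℕ) : IPoly := H.map fun row => row.getD i zeroI

/-- Real shadow of `colI`. [folklore] -/
noncomputable def colR (G : List (List ℝ)) (i : ℕ) : List ℝ := G.map fun row => row.getD i 0

/-- [folklore] -/
theorem pmem_colI {S : ℕ} : ∀ {G : List (List ℝ)} {H : IPoly2}, PMem2 S G H → ∀ i : ℕ, PMem S (colR G i) (colI H i)
  | _, _, List.Forall₂.nil, i => by simpa [colR, colI] using pmem_nil S
  | _, _, List.Forall₂.cons (a := g) (b := J) hg hG, i => by
      simp only [colR, colI, List.map_cons]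
      exact pmem_cons (mem_getD_of_pmem hg i) (pmem_colI hG i)

/-- [folklore] -/
theorem getD_colR (i : ℕ) : ∀ (G : List (List ℝ)) (k : ℕ), (colR G i).getD k 0 = (G.getD k []).getD i 0
  | [], k => by simp [colR]
  | g :: G, 0 => by simp [colR]
  | g :: G, k + 1 => by
      simp only [colR, List.map_cons, List.getD_cons_succ]
      exact getD_colR i G k

/-- [folklore] -/
theorem length_colR (G : List (List ℝ)) (i : ℕ) : (colR G i).length = G.length := by simp [colR]

/-- The largest row length (interval side). [folklore] -/
def rowMax2I (H : IPoly2) : ℕ := H.foldr (fun l n => max l.length n) 0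

/-- The largest row length (shadow side). [folklore] -/
def rowMax2 (G : List (List ℝ)) : ℕ := G.foldr (fun l n => max l.length n) 0

/-- [folklore] -/
theorem length_le_rowMax2_of_mem {G : List (List ℝ)} {l : List ℝ} (hl : l ∈ G) : l.length ≤ rowMax2 G := by
  unfold rowMax2
  induction G with
  | nil => simp at hl
  | cons g G ih =>
      simp only [List.foldr_cons]
      rcases List.mem_cons.mp hl with h | h
      · subst h; exact le_max_left _ _
      · exact le_max_of_le_right (ih h)

/-- [folklore] -/
theorem length_getD_le_rowMax2 (G : List (List ℝ)) (k : ℕ) : (G.getD k []).length ≤ rowMax2 G := by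
  by_cases hk : k < G.length
  · have hmem : G.getD k [] ∈ G := by
      rw [List.getD_eq_getElem?_getD, List.getElem?_eq_getElem hk, Option.getD_some]
      exact List.getElem_mem hk
    exact length_le_rowMax2_of_mem hmem
  · rw [List.getD_eq_default _ _ (not_lt.mp hk)]
    exact Nat.zero_le _

/-- The shadow's `rowMax2` is the twin's `rowMax2I`. [folklore] -/
theorem rowMax2_eq_of_pmem2 {S : ℕ} {G : List (List ℝ)} {H : IPoly2} (h : PMem2 S G H) :
    rowMax2 G = rowMax2I H := by
  unfold rowMax2 rowMax2I
  induction h with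
  | nil => rfl
  | cons hp _ ih => simp only [List.foldr_cons, length_eq_of_pmem hp, ih]

/-- **Column form**: `G(P,θ) = Σ_{i<M} c_i(θ) P^i` for any `M ≥ rowMax2 G`. [folklore] -/
theorem eval2_eq_sum_colR (G : List (List ℝ)) {M : ℕ} (hM : rowMax2 G ≤ M) (P θ : ℝ) :
    eval2 G P θ = ∑ i ∈ range M, evalR (colR G i) θ * P ^ i := by
  rw [eval2, evalR_eq_sum, List.length_map]
  have hrow : ∀ k : ℕ, (G.map fun l => evalR l P).getD k 0 * θ ^ k =
      ∑ i ∈ range M, (G.getD k []).getD i 0 * θ ^ k * P ^ i := by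
    intro k
    rw [getD_map_evalR, evalR_eq_sum_pad _ ((length_getD_le_rowMax2 G k).trans hM), Finset.sum_mul]
    exact Finset.sum_congr rfl fun i _ => by ring
  have hcol : ∀ i : ℕ, evalR (colR G i) θ = ∑ k ∈ range G.length, (G.getD k []).getD i 0 * θ ^ k := by
    intro i
    rw [evalR_eq_sum, length_colR]
    exact Finset.sum_congr rfl fun k _ => by rw [getD_colR]
  simp_rw [hrow, hcol, Finset.sum_mul]
  rw [Finset.sum_comm]

/-- The row of column VALUES at `θ`: `G(·,θ)` as a coefficient list in `P`. [folklore] -/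
noncomputable def colVals (G : List (List ℝ)) (M : ℕ) (θ : ℝ) : List ℝ :=
  (List.range M).map fun i => evalR (colR G i) θ

/-- [folklore] -/
theorem evalR_colVals (G : List (List ℝ)) {M : ℕ} (hM : rowMax2 G ≤ M) (P θ : ℝ) :
    evalR (colVals G M θ) P = eval2 G P θ := by
  rw [colVals, evalR_map_range, eval2_eq_sum_colR G hM]

/-- A column all of whose interval entries are the thin zero. [folklore] -/
def colZeroI (l : IPoly) : Bool := l.all fun I => decide (I.lo = 0 ∧ I.hi = 0)

/-- [folklore] -/
theorem evalR_eq_zero_of_colZeroI {S : ℕ} (hS : 0 < S) : ∀ {as : List ℝ} {l : IPoly}, PMem S as l →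
    colZeroI l = true → ∀ θ : ℝ, evalR as θ = 0
  | _, _, List.Forall₂.nil, _, θ => rfl
  | _, _, List.Forall₂.cons (a := a) (b := I) ha hP, hz, θ => by
      simp only [colZeroI, List.all_cons, Bool.and_eq_true, decide_eq_true_eq] at hz
      obtain ⟨⟨hlo, hhi⟩, hrest⟩ := hz
      have hSpos : (0 : ℝ) < S := by exact_mod_cast hS
      have h1 := ha.1; have h2 := ha.2
      rw [hlo, Int.cast_zero] at h1; rw [hhi, Int.cast_zero] at h2
      have ha0 : a = 0 := by nlinarith
      rw [evalR_cons, ha0, evalR_eq_zero_of_colZeroI hS hP (by simpa [colZeroI] using hrest) θ]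
      ring

/-- The EFFECTIVE number of columns: drop top columns that are identically the thin zero (padding from
exact cancellations or zero weights). [folklore] -/
def effCols (H : IPoly2) : ℕ → ℕ
  | 0 => 0
  | m + 1 => if colZeroI (colI H m) then effCols H m else m + 1

/-- [folklore] -/
theorem effCols_le (H : IPoly2) : ∀ M : ℕ, effCols H M ≤ M
  | 0 => le_rfl
  | m + 1 => by
      unfold effCols
      split_ifs
      · exact (effCols_le H m).trans (Nat.le_succ m)
      · exact le_rfl

/-- [folklore] -/
theorem colZeroI_of_effCols_le (H : IPoly2) : ∀ (M i : ℕ), effCols H M ≤ i → i < M → colZeroI (colI H i) = true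
  | 0, i, _, hi => absurd hi (Nat.not_lt_zero i)
  | m + 1, i, h, hi => by
      unfold effCols at h
      split_ifs at h with hz
      · rcases Nat.lt_succ_iff_lt_or_eq.mp hi with hlt | heq
        · exact colZeroI_of_effCols_le H m i h hlt
        · rw [heq]; exact hz
      · omega

/-- **Effective column form**: the dropped top columns vanish pointwise. [folklore] -/
theorem eval2_eq_sum_colR_eff {S : ℕ} (hS : 0 < S) {G : List (List ℝ)} {H : IPoly2} (hG : PMem2 S G H)
    {M : ℕ} (hM : rowMax2 G ≤ M) (P θ : ℝ) :
    eval2 G P θ = ∑ i ∈ range (effCols H M), evalR (colR G i) θ * P ^ i := by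
  rw [eval2_eq_sum_colR G hM P θ]
  symm
  refine Finset.sum_subset (range_subset_range.2 (effCols_le H M)) fun i hi hi' => ?_
  simp only [mem_range, not_lt] at hi hi'
  rw [evalR_eq_zero_of_colZeroI hS (pmem_colI hG i) (colZeroI_of_effCols_le H M i hi' hi) θ, zero_mul]

/-- [folklore] -/
theorem evalR_colVals_eff {S : ℕ} (hS : 0 < S) {G : List (List ℝ)} {H : IPoly2} (hG : PMem2 S G H)
    {M : ℕ} (hM : rowMax2 G ≤ M) (P θ : ℝ) :
    evalR (colVals G (effCols H M) θ) P = eval2 G P θ := by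
  rw [colVals, evalR_map_range, eval2_eq_sum_colR_eff hS hG hM]

/-- The row of column ENCLOSURES on the θ-cell `|θ - c| ≤ h`. [folklore] -/
def colEncl (S : ℕ) (H : IPoly2) (M : ℕ) (c h : ℚ) : IPoly :=
  (List.range M).map fun i => enclI S (colI H i) c h

/-- [folklore] -/
theorem pmem_colEncl {S : ℕ} (hS : 0 < S) {G : List (List ℝ)} {H : IPoly2} (hG : PMem2 S G H) (M : ℕ)
    {c h : ℚ} (h0 : 0 ≤ h) {θ : ℝ} (hθ : |θ - c| ≤ h) : PMem S (colVals G M θ) (colEncl S H M c h) :=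
  pmem_map (fun i => mem_enclI hS (pmem_colI hG i) h0 hθ) (List.range M)

/-! ### The checker -/

/-- Parameters: switch point `P₁` (box part on `[P₀, P₁]`, Cauchy bound beyond), number of θ-cells, `posOn` depth.
[folklore] -/
structure HSParams where
  /-- right end of the θ-range `[0, θhi]` (`> 0`; `θhi = 1` for the full region) -/
  θhi : ℚ
  /-- switch point between the box part and the unbounded part (`≥ 1`) -/
  P1 : ℚ
  /-- number of uniform θ-cells of `[0, θhi]` in the box part (`≥ 1`) -/
  nθ : ℕ
  /-- bisection depth of `posOn` in `P` -/
  dP : ℕ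
  deriving DecidableEq, Repr

/-- Sum of the scaled absolute bounds of the columns `i < d` on `θ ∈ [0,1]`. [folklore] -/
def lowColsAbs (S : ℕ) (H : IPoly2) (η : ℚ) : ℕ → ℤ
  | 0 => 0
  | d + 1 => lowColsAbs S H η d + (enclI S (colI H d) η η).absHi

/-- [folklore] -/
theorem cast_lowColsAbs (S : ℕ) (H : IPoly2) (η : ℚ) : ∀ d : ℕ,
    ((lowColsAbs S H η d : ℤ) : ℝ) = ∑ i ∈ range d, ((enclI S (colI H i) η η).absHi : ℝ)
  | 0 => by simp [lowColsAbs]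
  | d + 1 => by rw [lowColsAbs, Int.cast_add, cast_lowColsAbs S H η d, Finset.sum_range_succ]

/-- The box part: every θ-cell `[θhi·k/n, θhi·(k+1)/n]` passes `posOn` on `[P₀, P₁]`. [folklore] -/
def boxPart (S : ℕ) (H : IPoly2) (M : ℕ) (P0 P1 θhi : ℚ) (n dP : ℕ) : Bool :=
  (List.range n).all fun k =>
    posOn S dP (colEncl S H M (θhi * (2 * (k : ℚ) + 1) / (2 * (n : ℚ))) (θhi / (2 * (n : ℚ)))) P0 P1

/-- **The half-strip positivity checker** on `{P ≥ P₀} × [0, θhi]` (module docstring). [folklore] -/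
def halfStripPos (S : ℕ) (H : IPoly2) (P0 : ℚ) (prm : HSParams) : Bool :=
  match effCols H (rowMax2I H) with
  | 0 => false
  | d + 1 =>
      decide (0 < prm.θhi) &&
      decide (0 < (enclI S (colI H d) (prm.θhi / 2) (prm.θhi / 2)).lo) &&
      decide ((1 : ℚ) ≤ prm.P1) &&
      decide (((lowColsAbs S H (prm.θhi / 2) d : ℤ) : ℚ) <
        ((enclI S (colI H d) (prm.θhi / 2) (prm.θhi / 2)).lo : ℚ) * prm.P1) &&
      (decide (prm.P1 ≤ P0) ||
        (decide (0 < prm.nθ) && boxPart S H (d + 1) P0 prm.P1 prm.θhi prm.nθ prm.dP))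

/-! ### Soundness -/

/-- `|x·S| ≤ absHi`. [folklore] -/
theorem abs_mul_le_absHi {S : ℕ} {x : ℝ} {I : MI} (hx : MI.mem S x I) : |x * S| ≤ (I.absHi : ℝ) := by
  have h := MI.abs_le_absHi hx
  rwa [abs_mul, abs_of_nonneg (by positivity : (0 : ℝ) ≤ S)]

/-- The lower columns are bounded by `lowColsAbs · P^{d-1}` (scaled) for `P ≥ 1`, `θ ∈ [0, 2η]`. [folklore] -/
theorem sum_low_cols_le {S : ℕ} (hS : 0 < S) {G : List (List ℝ)} {H : IPoly2} (hG : PMem2 S G H) (d : ℕ)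
    {η : ℚ} {θ : ℝ} (hθ : |θ - η| ≤ η) {P : ℝ} (hP1 : 1 ≤ P) :
    |∑ i ∈ range d, evalR (colR G i) θ * P ^ i| * S ≤ (lowColsAbs S H η d : ℝ) * P ^ (d - 1) := by
  have hη : (0 : ℚ) ≤ η := by
    have : (0 : ℝ) ≤ η := (abs_nonneg _).trans hθ
    exact_mod_cast this
  have hSpos : (0 : ℝ) < S := by exact_mod_cast hS
  have hterm : ∀ i ∈ range d, |evalR (colR G i) θ * P ^ i| * S ≤
      ((enclI S (colI H i) η η).absHi : ℝ) * P ^ (d - 1) := by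
    intro i hi
    have hmem := mem_enclI hS (pmem_colI hG i) hη hθ
    have hab := abs_mul_le_absHi hmem
    have hPi : P ^ i ≤ P ^ (d - 1) := pow_le_pow_right₀ hP1 (by simp only [mem_range] at hi; omega)
    have hP0 : 0 ≤ P ^ i := by positivity
    have hA0 : (0 : ℝ) ≤ ((enclI S (colI H i) η η).absHi : ℝ) := by exact_mod_cast Literature.MathematicalPhysics.QuantumFieldTheory.ConformalBootstrap3D.HRTM.absHi_nonneg _
    calc |evalR (colR G i) θ * P ^ i| * S = |evalR (colR G i) θ * S| * P ^ i := by
          rw [abs_mul, abs_mul, abs_of_nonneg hP0, abs_of_nonneg hSpos.le]; ring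
      _ ≤ ((enclI S (colI H i) η η).absHi : ℝ) * P ^ i := mul_le_mul_of_nonneg_right hab hP0
      _ ≤ ((enclI S (colI H i) η η).absHi : ℝ) * P ^ (d - 1) := mul_le_mul_of_nonneg_left hPi hA0
  calc |∑ i ∈ range d, evalR (colR G i) θ * P ^ i| * S
      ≤ (∑ i ∈ range d, |evalR (colR G i) θ * P ^ i|) * S :=
        mul_le_mul_of_nonneg_right (Finset.abs_sum_le_sum_abs _ _) hSpos.le
    _ = ∑ i ∈ range d, |evalR (colR G i) θ * P ^ i| * S := by rw [Finset.sum_mul]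
    _ ≤ ∑ i ∈ range d, ((enclI S (colI H i) η η).absHi : ℝ) * P ^ (d - 1) := Finset.sum_le_sum hterm
    _ = (lowColsAbs S H η d : ℝ) * P ^ (d - 1) := by rw [← Finset.sum_mul, cast_lowColsAbs]

/-- **Soundness of the half-strip checker.** [folklore] -/
theorem halfStripPos_sound {S : ℕ} (hS : 0 < S) {G : List (List ℝ)} {H : IPoly2} (hG : PMem2 S G H)
    {P0 : ℚ} {prm : HSParams} (h : halfStripPos S H P0 prm = true) {P θ : ℝ} (hP : (P0 : ℝ) ≤ P)
    (hθ0 : 0 ≤ θ) (hθ1 : θ ≤ prm.θhi) : 0 < eval2 G P θ := by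
  have hsz : rowMax2 G = rowMax2I H := rowMax2_eq_of_pmem2 hG
  have hsize0 : rowMax2 G ≤ rowMax2I H := hsz.le
  unfold halfStripPos at h
  have hSpos : (0 : ℝ) < S := by exact_mod_cast hS
  cases hM : effCols H (rowMax2I H) with
  | zero => rw [hM] at h; exact absurd h (by simp)
  | succ d =>
    rw [hM] at h
    simp only [Bool.and_eq_true, Bool.or_eq_true, decide_eq_true_eq] at h
    obtain ⟨⟨⟨⟨hη, hL⟩, hP1⟩, hCauchy⟩, hbox⟩ := h
    have hcolform : eval2 G P θ = ∑ i ∈ range (d + 1), evalR (colR G i) θ * P ^ i := by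
      rw [eval2_eq_sum_colR_eff hS hG hsize0 P θ, hM]
    have hθc : |θ - ((prm.θhi / 2 : ℚ) : ℝ)| ≤ ((prm.θhi / 2 : ℚ) : ℝ) := by
      push_cast; rw [abs_le]; constructor <;> linarith
    by_cases hPP : (prm.P1 : ℝ) ≤ P
    · -- unbounded part: Cauchy-type bound
      have hP1' : (1 : ℝ) ≤ P := le_trans (by exact_mod_cast hP1) hPP
      have htop : ((enclI S (colI H d) (prm.θhi / 2) (prm.θhi / 2)).lo : ℝ) ≤ evalR (colR G d) θ * S :=
        (mem_enclI hS (pmem_colI hG d) (by positivity) hθc).1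
      have hlow := sum_low_cols_le hS hG d hθc hP1'
      have hLpos : (0 : ℝ) < ((enclI S (colI H d) (prm.θhi / 2) (prm.θhi / 2)).lo : ℝ) := by
        exact_mod_cast hL
      have hC : ((lowColsAbs S H (prm.θhi / 2) d : ℤ) : ℝ) <
          ((enclI S (colI H d) (prm.θhi / 2) (prm.θhi / 2)).lo : ℝ) * prm.P1 := by
        exact_mod_cast hCauchy
      rw [hcolform, Finset.sum_range_succ]
      set A := ∑ i ∈ range d, evalR (colR G i) θ * P ^ i with hAdef
      set c := evalR (colR G d) θ with hcdef
      set L : ℝ := ((enclI S (colI H d) (prm.θhi / 2) (prm.θhi / 2)).lo : ℝ) with hLdef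
      set B : ℝ := ((lowColsAbs S H (prm.θhi / 2) d : ℤ) : ℝ) with hBdef
      have hA : -(B * P ^ (d - 1)) ≤ A * S := by
        have h1 : |A| * S = |A * S| := by rw [abs_mul, abs_of_nonneg hSpos.le]
        rw [h1] at hlow
        linarith [neg_abs_le (A * S)]
      have h2 : L * P ^ d ≤ c * S * P ^ d := mul_le_mul_of_nonneg_right htop (by positivity)
      have key : 0 < (A + c * P ^ d) * S := by
        cases d with
        | zero =>
            have hA0 : A = 0 := by rw [hAdef]; simp
            rw [hA0, zero_add, pow_zero, mul_one]
            have : L * P ^ 0 ≤ c * S * P ^ 0 := h2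
            simp only [pow_zero, mul_one] at this
            linarith
        | succ d' =>
            simp only [Nat.add_sub_cancel] at hA
            have hPd' : 0 < P ^ d' := by positivity
            have hLP : B < L * P := lt_of_lt_of_le hC (mul_le_mul_of_nonneg_left hPP hLpos.le)
            calc (0 : ℝ) < (L * P - B) * P ^ d' := mul_pos (by linarith) hPd'
              _ = -(B * P ^ d') + L * P ^ (d' + 1) := by ring
              _ ≤ A * S + c * S * P ^ (d' + 1) := add_le_add hA h2
              _ = (A + c * P ^ (d' + 1)) * S := by ring
      exact (mul_pos_iff_of_pos_right hSpos).mp key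
    · -- box part: `P₀ ≤ P < P₁`, locate the θ-cell and use `posOn`
      have hlt : P < (prm.P1 : ℝ) := lt_of_not_ge hPP
      rcases hbox with hvac | ⟨hn, hall⟩
      · exact absurd ((show ((prm.P1 : ℚ) : ℝ) ≤ (P0 : ℝ) by exact_mod_cast hvac).trans hP) hPP
      · have hnR : (0 : ℝ) < prm.nθ := by exact_mod_cast hn
        have hηR : (0 : ℝ) < prm.θhi := by exact_mod_cast hη
        have hn1 : prm.nθ - 1 + 1 = prm.nθ := Nat.sub_add_cancel hn
        obtain ⟨k, hk, hk1, hk2⟩ := exists_mem_gridCell (fun k : ℕ => (prm.θhi : ℝ) * k / prm.nθ) (prm.nθ - 1)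
          (Δ := θ) (by simpa using hθ0) (by
            show θ ≤ (prm.θhi : ℝ) * ((prm.nθ - 1 + 1 : ℕ) : ℝ) / prm.nθ
            rw [hn1, mul_div_assoc, div_self hnR.ne', mul_one]; exact hθ1)
        have hk1' : (prm.θhi : ℝ) * k / prm.nθ ≤ θ := hk1
        have hk2' : θ ≤ (prm.θhi : ℝ) * ((k : ℝ) + 1) / prm.nθ := by
          have : θ ≤ (prm.θhi : ℝ) * ((k + 1 : ℕ) : ℝ) / prm.nθ := hk2
          push_cast at this; exact this
        have hkn : k < prm.nθ := by omega
        have hposk := List.all_eq_true.mp hall k (List.mem_range.mpr hkn)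
        have hid1 : (prm.θhi : ℝ) * (2 * (k : ℝ) + 1) / (2 * prm.nθ) - prm.θhi / (2 * prm.nθ) =
            (prm.θhi : ℝ) * k / prm.nθ := by
          field_simp; ring
        have hid2 : (prm.θhi : ℝ) * (2 * (k : ℝ) + 1) / (2 * prm.nθ) + prm.θhi / (2 * prm.nθ) =
            (prm.θhi : ℝ) * ((k : ℝ) + 1) / prm.nθ := by
          field_simp; ring
        have hc : |θ - ((prm.θhi * (2 * (k : ℚ) + 1) / (2 * (prm.nθ : ℚ)) : ℚ) : ℝ)| ≤
            ((prm.θhi / (2 * (prm.nθ : ℚ)) : ℚ) : ℝ) := by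
          push_cast
          rw [abs_le]
          constructor <;> linarith
        have hh0 : (0 : ℚ) ≤ prm.θhi / (2 * (prm.nθ : ℚ)) := by
          have : (0 : ℚ) < prm.nθ := by exact_mod_cast hn
          positivity
        have hpm := pmem_colEncl hS hG (d + 1) hh0 hc
        have hP0P1 : P0 ≤ prm.P1 := by
          have : (P0 : ℝ) ≤ prm.P1 := hP.trans hlt.le
          exact_mod_cast this
        have hpos := posOn_sound hS hposk hP0P1 hpm hP hlt.le
        have hcv : evalR (colVals G (d + 1) θ) P = eval2 G P θ := by
          rw [← hM, evalR_colVals_eff hS hG hsize0]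
        rwa [hcv] at hpos

end Summit.CriticalPhenomena.Ising3D
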